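import Summits.Ventures.PercRepro.Night2T3Identity

/-!
# PercRepro — the `q`-free counting criterion for the type-`3` balance (night-2, NIGHT-2-t3.md §5, Cor. A3)

Lemma A (`Jq_three_eq`) writes the type-`3` balance of a rank-`q` set `G` of a simple matroid as
`J_3 = DF_3 − (N_q − DF_3 + 2·#𝓑)/(q + 1) + Σ_{S spanning non-basis} (q − 2 − m(S))/(1 + m(S))`.
Since `1 + m(S) ≤ q + 1`, every low-coloop term is at least its `q`-free shadow `(q − 2 − m(S))/(q + 1)`, and
multiplying by `q + 1` gives
`(q + 1)·J_3 ≥ (q + 2)·DF_3 − 3·#𝓑 + Σ_{S spanning non-basis} (q − 3 − m(S)) = (q + 2)·DF_3 + Σ_{S ∈ R_q(G)} (q − 3 − m(S))`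
(a basis has `m = q`, i.e. the term `−3`).  Hence (**Corollary A3**, the `q`-free criterion):
`0 ≤ (q + 2)·DF_3 + Σ_{S ∈ R_q(G)} (q − 3 − m(S))  →  0 ≤ J_3`.
For `G = N ⊕ (q − r) coloops` the right-hand quantity is `(q + 2)·nd(N) + Σ_{S spanning N} (ρ(S) − 3)` with
`ρ(S) = r − m_N(S)` the rank of the cyclic part of `S` — it does not decrease with the number of coloops, so the
criterion at `q = r` settles the balance for every `q`.  Imports `Night2T3Identity` only.
-/
namespace PercRepro.Star

open Finset ThmH SixFour GenQ

variable {α : Type*} [DecidableEq α] {M : Matroid α} [M.Finite]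

/-! ## The low-coloop sum dominates its `q`-free shadow -/

/-- For `0 ≤ q − 2 − m` and `m ≤ q`: `(q − 2 − m)/(q + 1) ≤ (q − 2 − m)/(1 + m)`. -/
theorem shadow_le_term {q m : ℕ} (hm : m + 2 ≤ q) :
    ((q : ℚ) - 2 - (m : ℚ)) / ((q : ℚ) + 1) ≤ ((q : ℚ) - 2 - (m : ℚ)) / (1 + (m : ℚ)) := by
  have hnum : (0 : ℚ) ≤ (q : ℚ) - 2 - (m : ℚ) := by
    have : (m : ℚ) + 2 ≤ (q : ℚ) := by exact_mod_cast hm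
    linarith
  have hden : (0 : ℚ) < 1 + (m : ℚ) := by positivity
  have hle : (1 : ℚ) + (m : ℚ) ≤ (q : ℚ) + 1 := by
    have : (m : ℚ) ≤ (q : ℚ) := by exact_mod_cast (by omega : m ≤ q)
    linarith
  exact div_le_div_of_nonneg_left hnum hden hle

/-- `Σ_{S spanning non-basis} (q − 2 − m(S)) ≤ (q + 1)·lowSum` on a simple matroid. -/
theorem sum_shadow_le_lowSum (hs : Simple M) {G : Finset α} {q : ℕ} (hG : G ⊆ gr M) (hq : 1 ≤ q) :
    ∑ S ∈ SNq M G q, ((q : ℚ) - 2 - (mTr M S : ℚ)) ≤ ((q : ℚ) + 1) * lowSum M G q := by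
  unfold lowSum
  rw [Finset.mul_sum]
  apply Finset.sum_le_sum
  intro S hS
  have hS' := mem_SNq.1 hS
  have hm := mTr_add_two_le_of_spanning_nonbasis hs (hS'.1.trans hG) hS'.2.1 hq (lt_card_of_mem_SNq hS)
  have h := shadow_le_term (q := q) (m := mTr M S) hm
  have hpos : (0 : ℚ) < (q : ℚ) + 1 := by positivity
  calc ((q : ℚ) - 2 - (mTr M S : ℚ))
      = ((q : ℚ) + 1) * (((q : ℚ) - 2 - (mTr M S : ℚ)) / ((q : ℚ) + 1)) := by
        field_simp
    _ ≤ ((q : ℚ) + 1) * (((q : ℚ) - 2 - (mTr M S : ℚ)) / (1 + (mTr M S : ℚ))) :=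
        mul_le_mul_of_nonneg_left h hpos.le

/-! ## The criterion -/

/-- **The `q`-free counting bound**:
`(q + 2)·DF_3 − 3·#𝓑 + Σ_{S spanning non-basis} (q − 3 − m(S)) ≤ (q + 1)·J_3` on a simple matroid. -/
theorem count_le_Jq_three (hs : Simple M) {G : Finset α} {q : ℕ} (hG : G ⊆ gr M) (hq : 1 ≤ q) :
    ((q : ℚ) + 2) * (DFq M G q 3 : ℚ) - 3 * ((Bq M G q).card : ℚ) +
        ∑ S ∈ SNq M G q, ((q : ℚ) - 3 - (mTr M S : ℚ)) ≤
      ((q : ℚ) + 1) * Jq M G q 3 := by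
  have hA := Jq_three_eq (M := M) G q
  have hcard := card_SNq_eq (M := M) G q
  have hlow := sum_shadow_le_lowSum hs hG hq
  have hsplit : ∑ S ∈ SNq M G q, ((q : ℚ) - 3 - (mTr M S : ℚ)) =
      ∑ S ∈ SNq M G q, ((q : ℚ) - 2 - (mTr M S : ℚ)) - ((SNq M G q).card : ℚ) := by
    have hterm : ∀ S ∈ SNq M G q,
        ((q : ℚ) - 3 - (mTr M S : ℚ)) = ((q : ℚ) - 2 - (mTr M S : ℚ)) - 1 := by
      intro S _
      ring
    rw [Finset.sum_congr rfl hterm, Finset.sum_sub_distrib, Finset.sum_const, nsmul_eq_mul, mul_one]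
  have hpos : (0 : ℚ) < (q : ℚ) + 1 := by positivity
  have hJ : ((q : ℚ) + 1) * Jq M G q 3 =
      ((q : ℚ) + 2) * (DFq M G q 3 : ℚ) - (Nq M G q : ℚ) - 2 * ((Bq M G q).card : ℚ) +
        ((q : ℚ) + 1) * lowSum M G q := by
    rw [hA]
    field_simp
    ring
  rw [hJ, hsplit]
  linarith

/-- **Corollary A3, the `q`-free criterion**: if
`3·#𝓑 ≤ (q + 2)·DF_3 + Σ_{S spanning non-basis} (q − 3 − m(S))` then `0 ≤ J_3`. -/
theorem Jq_three_nonneg_of_count (hs : Simple M) {G : Finset α} {q : ℕ} (hG : G ⊆ gr M) (hq : 1 ≤ q)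
    (h : 3 * ((Bq M G q).card : ℚ) ≤
      ((q : ℚ) + 2) * (DFq M G q 3 : ℚ) + ∑ S ∈ SNq M G q, ((q : ℚ) - 3 - (mTr M S : ℚ))) :
    0 ≤ Jq M G q 3 := by
  have hle := count_le_Jq_three hs hG hq
  have hpos : (0 : ℚ) < (q : ℚ) + 1 := by positivity
  have h0 : (0 : ℚ) ≤ ((q : ℚ) + 1) * Jq M G q 3 := by linarith
  by_contra hneg
  push Not at hneg
  have hlt : ((q : ℚ) + 1) * Jq M G q 3 < 0 := mul_neg_of_pos_of_neg hpos hneg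
  linarith

end PercRepro.Star
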